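import Summits.QuantumFields.YangMills.Theorems.ConvexGribovBodyBrascampLiebVacuumSCInvolutionSplitHelpers

/-!
# Crux `BrascampLiebVacuumSC` (stmt-QuantumFields-16404), line `SketchIdeator1`, skeleton v8:
# stub `stub_involutionSplit` — the Cartan decomposition count `dim 𝔭 ≤ dim 𝔨 + dim 𝔞`

Registered stub of skeleton v8 (lead c4). For a real subspace `L ⊆ M_N(ℂ)` closed under the commutator and
consisting of skew-Hermitian matrices, with the real structure of `L_ℂ = span_ℂ L` and the joint weight
decompositions of `L_ℂ` under abelian subspaces GIVEN as hypotheses, and an involution `P` (`P² = 1`)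
normalising `L`: with `θ X = P X P`, `𝔨 = L^θ`, `𝔭 = L^{-θ}` we produce an abelian `𝔞 ⊆ 𝔭` with
`dim 𝔭 ≤ dim 𝔨 + dim 𝔞` and `dim 𝔭 + dim 𝔨 = dim L`.

Proof (classical restricted-root count; the linear algebra is in `Theorems/…InvolutionSplitHelpers.lean`, where
`θ = LinearMap.mulLeftRight _ (P, P)`, `𝔭 = L ⊓ ker (θ + 1)`, `𝔨 = L ⊓ ker (θ - 1)`, `𝔭_ℂ = L_ℂ ⊓ ker (θ + 1)`):
`𝔞` is an abelian subspace of `𝔭` of maximal dimension (hence its own commutant in `𝔭`). Decompose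
`L_ℂ = E₀ ⊕ N`, `N = ⨆_{w ≠ 0} E_w`, under `ad 𝔞` (hypothesis). Since `θ = -1` on `𝔞`, `θ E_w ⊆ E_{-w}`
(`conj_mem_weight`), so `E₀` and `N` are `θ`-stable and `𝔭_ℂ` splits as `(𝔭_ℂ ∩ E₀) ⊕ (𝔭_ℂ ∩ N)`.
Maximality and the real structure give `𝔭_ℂ ∩ E₀ ⊆ 𝔞_ℂ` (`pPart_inf_weightZero_le`), while
`2 dim (𝔭_ℂ ∩ N) ≤ dim N` because `w ↦ -w` has no non-zero fixed point (`InvolutionSplit.two_mul_finrank_le`).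
With `dim_ℂ L_ℂ = dim L = dim 𝔨 + dim 𝔭`, `dim 𝔭 ≤ dim_ℂ 𝔭_ℂ`, `dim_ℂ 𝔞_ℂ = dim 𝔞 ≤ dim E₀` this gives
`2 dim 𝔭 ≤ 2 dim 𝔞 + dim N ≤ dim 𝔞 + dim L`, i.e. `dim 𝔭 ≤ dim 𝔨 + dim 𝔞`. Only conjuncts E1–E3 of the weight
decomposition and the three real-structure facts are used; unitarity of `P` is not needed beyond `P² = 1`.
No named facts; everything is proved.
-/

set_option autoImplicit false

open scoped Matrix
open LinearMap (ker mulLeftRight mulLeftRight_apply)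

noncomputable section

namespace Summit.QuantumFields.YangMills.Theorems.BrascampLiebVacuumSC

namespace InvolutionSplit

variable {N : ℕ}

/-- **`θ E_w ⊆ E_{-w}`.** If `P² = 1`, `θ L ⊆ L` and `θ = -1` on `A`, then every `H ∈ A` anticommutes with
`P`, so `[H, θ Z] = -θ [H, Z]` and `θ` maps the weight space `E_w` of `ad A` into `E_{-w}`. [folklore] -/
theorem conj_mem_weight {L A : Submodule ℝ (Matrix (Fin N) (Fin N) ℂ)} {P : Matrix (Fin N) (Fin N) ℂ}
    (hP : P * P = 1) (hPL : ∀ X ∈ L, P * X * P ∈ L) (hA : ∀ H ∈ A, P * H * P = -H)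
    {E : (↥A →ₗ[ℝ] ℝ) → Submodule ℂ (Matrix (Fin N) (Fin N) ℂ)}
    (hE1 : ∀ w, (E w : Set (Matrix (Fin N) (Fin N) ℂ)) =
      {Z | Z ∈ Submodule.span ℂ (L : Set (Matrix (Fin N) (Fin N) ℂ)) ∧
        ∀ H : ↥A, (H : Matrix (Fin N) (Fin N) ℂ) * Z - Z * (H : Matrix (Fin N) (Fin N) ℂ) =
          ((((w H : ℝ) : ℂ)) * Complex.I) • Z})
    (w : ↥A →ₗ[ℝ] ℝ) {Z : Matrix (Fin N) (Fin N) ℂ} (hZ : Z ∈ E w) : P * Z * P ∈ E (-w) := by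
  rw [← SetLike.mem_coe, hE1] at hZ ⊢
  obtain ⟨hZL, hZw⟩ := hZ
  refine ⟨conj_mem_span hPL hZL, fun H => ?_⟩
  have hHP : (H : Matrix (Fin N) (Fin N) ℂ) * P = -(P * H) := by
    have h : P * (P * (H : Matrix (Fin N) (Fin N) ℂ) * P) = P * -(H : Matrix (Fin N) (Fin N) ℂ) := by
      rw [hA H H.2]
    rwa [← Matrix.mul_assoc, ← Matrix.mul_assoc, hP, Matrix.one_mul, Matrix.mul_neg] at h
  have hPH : P * (H : Matrix (Fin N) (Fin N) ℂ) = -(H * P) := by rw [hHP, neg_neg]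
  have e1 : (H : Matrix (Fin N) (Fin N) ℂ) * (P * Z * P) = -(P * ((H : Matrix (Fin N) (Fin N) ℂ) * Z) * P) := by
    rw [← Matrix.mul_assoc, ← Matrix.mul_assoc, hHP, Matrix.neg_mul, Matrix.neg_mul]
    simp only [Matrix.mul_assoc]
  have e2 : P * Z * P * (H : Matrix (Fin N) (Fin N) ℂ) = -(P * (Z * (H : Matrix (Fin N) (Fin N) ℂ)) * P) := by
    rw [Matrix.mul_assoc, hPH, Matrix.mul_neg]
    simp only [Matrix.mul_assoc]
  calc (H : Matrix (Fin N) (Fin N) ℂ) * (P * Z * P) - P * Z * P * H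
        = -(P * ((H : Matrix (Fin N) (Fin N) ℂ) * Z - Z * H) * P) := by
        rw [e1, e2, Matrix.mul_sub, Matrix.sub_mul]; abel
    _ = ((((-w) H : ℝ) : ℂ) * Complex.I) • (P * Z * P) := by
        rw [hZw H, Matrix.mul_smul, Matrix.smul_mul, LinearMap.neg_apply, Complex.ofReal_neg, neg_mul,
          neg_smul]

/-- **`𝔞_ℂ ⊆ E₀`.** The complex span of the abelian `A ≤ L` lies in the zero weight space. [folklore] -/
theorem span_le_weightZero {L A : Submodule ℝ (Matrix (Fin N) (Fin N) ℂ)} (hAL : A ≤ L)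
    (hAab : ∀ H ∈ A, ∀ H' ∈ A, H * H' = H' * H) {E : (↥A →ₗ[ℝ] ℝ) → Submodule ℂ (Matrix (Fin N) (Fin N) ℂ)}
    (hE1 : ∀ w, (E w : Set (Matrix (Fin N) (Fin N) ℂ)) =
      {Z | Z ∈ Submodule.span ℂ (L : Set (Matrix (Fin N) (Fin N) ℂ)) ∧
        ∀ H : ↥A, (H : Matrix (Fin N) (Fin N) ℂ) * Z - Z * (H : Matrix (Fin N) (Fin N) ℂ) =
          ((((w H : ℝ) : ℂ)) * Complex.I) • Z}) :
    Submodule.span ℂ (A : Set (Matrix (Fin N) (Fin N) ℂ)) ≤ E 0 := by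
  refine Submodule.span_le.2 fun H' hH' => ?_
  rw [hE1]
  refine ⟨Submodule.subset_span (hAL hH'), fun H => ?_⟩
  rw [hAab H H.2 H' hH', sub_self, LinearMap.zero_apply, Complex.ofReal_zero, zero_mul, zero_smul]

/-- **`𝔭_ℂ ∩ E₀ ⊆ 𝔞_ℂ` (maximality).** For `Z = X + iY ∈ L_ℂ` (`X, Y ∈ L`) with `θ Z = -Z` and `[A, Z] = 0`,
the real structure (`X + iY = 0 ⇒ X = Y = 0` on `L`) gives `θ X = -X`, `θ Y = -Y` and `[A, X] = [A, Y] = 0`,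
so `X, Y ∈ A` when `A` is its own commutant in `𝔭`. [folklore] -/
theorem pPart_inf_weightZero_le {L A : Submodule ℝ (Matrix (Fin N) (Fin N) ℂ)} {P : Matrix (Fin N) (Fin N) ℂ}
    (hbr : ∀ X ∈ L, ∀ Y ∈ L, X * Y - Y * X ∈ L)
    (h2 : ∀ Z ∈ Submodule.span ℂ (L : Set (Matrix (Fin N) (Fin N) ℂ)), ∃ X ∈ L, ∃ Y ∈ L,
      Z = X + Complex.I • Y)
    (h3 : ∀ X ∈ L, ∀ Y ∈ L, X + Complex.I • Y = 0 → X = 0 ∧ Y = 0)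
    (hPL : ∀ X ∈ L, P * X * P ∈ L) (hAL : A ≤ L)
    (hmax : ∀ X ∈ L ⊓ ker (mulLeftRight ℝ (P, P) + 1), (∀ H ∈ A, H * X = X * H) → X ∈ A)
    {E : (↥A →ₗ[ℝ] ℝ) → Submodule ℂ (Matrix (Fin N) (Fin N) ℂ)}
    (hE1 : ∀ w, (E w : Set (Matrix (Fin N) (Fin N) ℂ)) =
      {Z | Z ∈ Submodule.span ℂ (L : Set (Matrix (Fin N) (Fin N) ℂ)) ∧
        ∀ H : ↥A, (H : Matrix (Fin N) (Fin N) ℂ) * Z - Z * (H : Matrix (Fin N) (Fin N) ℂ) =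
          ((((w H : ℝ) : ℂ)) * Complex.I) • Z}) :
    (Submodule.span ℂ (L : Set (Matrix (Fin N) (Fin N) ℂ)) ⊓ ker (mulLeftRight ℂ (P, P) + 1)) ⊓ E 0 ≤
      Submodule.span ℂ (A : Set (Matrix (Fin N) (Fin N) ℂ)) := by
  rintro Z ⟨hZp, hZ0⟩
  obtain ⟨hZL, hθZ⟩ := mem_pPart.1 hZp
  have hZ0' : Z ∈ (E 0 : Set (Matrix (Fin N) (Fin N) ℂ)) := hZ0
  rw [hE1] at hZ0'
  obtain ⟨-, hZ0⟩ := hZ0'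
  obtain ⟨X, hX, Y, hY, rfl⟩ := h2 Z hZL
  have hθ : (P * X * P + X) + Complex.I • (P * Y * P + Y) = 0 := by
    calc (P * X * P + X) + Complex.I • (P * Y * P + Y)
          = P * (X + Complex.I • Y) * P + (X + Complex.I • Y) := by
            rw [Matrix.mul_add, Matrix.add_mul, Matrix.mul_smul, Matrix.smul_mul, smul_add]; abel
      _ = 0 := by rw [hθZ, neg_add_cancel]
  obtain ⟨eX, eY⟩ := h3 _ (add_mem (hPL X hX) hX) _ (add_mem (hPL Y hY) hY) hθ
  have hXp : X ∈ L ⊓ ker (mulLeftRight ℝ (P, P) + 1) := mem_pPart.2 ⟨hX, eq_neg_of_add_eq_zero_left eX⟩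
  have hYp : Y ∈ L ⊓ ker (mulLeftRight ℝ (P, P) + 1) := mem_pPart.2 ⟨hY, eq_neg_of_add_eq_zero_left eY⟩
  have hcomm : ∀ H ∈ A, H * X = X * H ∧ H * Y = Y * H := by
    intro H hH
    have h := hZ0 ⟨H, hH⟩
    simp only [LinearMap.zero_apply, Complex.ofReal_zero, zero_mul, zero_smul] at h
    have h' : (H * X - X * H) + Complex.I • (H * Y - Y * H) = 0 := by
      rw [← h, Matrix.mul_add, Matrix.add_mul, Matrix.mul_smul, Matrix.smul_mul, smul_sub]; abel
    obtain ⟨c1, c2⟩ := h3 _ (hbr H (hAL hH) X hX) _ (hbr H (hAL hH) Y hY) h'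
    exact ⟨sub_eq_zero.1 c1, sub_eq_zero.1 c2⟩
  have hXA : X ∈ A := hmax X hXp fun H hH => (hcomm H hH).1
  have hYA : Y ∈ A := hmax Y hYp fun H hH => (hcomm H hH).2
  exact add_mem (Submodule.subset_span hXA) (Submodule.smul_mem _ _ (Submodule.subset_span hYA))

end InvolutionSplit

open InvolutionSplit in
/-- **Stub (LIE THEORY — Cartan decomposition count for an involution: `dim 𝔭 ≤ dim 𝔨 + dim 𝔞`).**
For `L ⊆ 𝔲(N)` bracket-closed (real structure and weight decompositions given as hypotheses) and a unitary
involution `P` (`P² = 1`) normalising `L`, `θ X = P X P` is an involutive automorphism of `L`;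
`𝔨 = L^θ`, `𝔭 = L^{−θ}`, `L = 𝔨 ⊕ 𝔭`. With `𝔞 ⊆ 𝔭` a maximal abelian subspace, decompose `L_ℂ` under `ad 𝔞`:
`θ E_w = E_{−w}` (as `θ = −1` on `𝔞`), so on `N = ⨁_{w≠0} E_w = U ⊕ θU` the maps `u ↦ u ± θu` identify `U`
with `N ∩ 𝔨_ℂ` and `N ∩ 𝔭_ℂ` (equal dimensions), while `E_0 ∩ 𝔭_ℂ = 𝔞_ℂ` by maximality; hence
`dim 𝔭 − dim 𝔨 = dim 𝔞 − dim(E_0 ∩ 𝔨_ℂ) ≤ dim 𝔞` (restricted roots: `dim 𝔭 − dim 𝔨 = dim 𝔞 − dim 𝔪`).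
[cite: Knapp2002, Ch. VI §4 (restricted roots)] [cite: Helgason1978, Ch. V §1] -/
theorem stub_involutionSplit :
    ∀ (N : ℕ) (L : Submodule ℝ (Matrix (Fin N) (Fin N) ℂ)) (P : Matrix (Fin N) (Fin N) ℂ),
      (∀ X ∈ L, ∀ Y ∈ L, X * Y - Y * X ∈ L) → (∀ X ∈ L, star X = -X) →
        ((∀ W : Submodule ℝ (Matrix (Fin N) (Fin N) ℂ), (∀ X ∈ W, star X = -X) →
            Module.finrank ℂ ↥(Submodule.span ℂ (W : Set (Matrix (Fin N) (Fin N) ℂ))) = Module.finrank ℝ ↥W) ∧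
          (∀ Z ∈ Submodule.span ℂ (L : Set (Matrix (Fin N) (Fin N) ℂ)), ∃ X ∈ L, ∃ Y ∈ L, Z = X + Complex.I • Y) ∧
          (∀ X ∈ L, ∀ Y ∈ L, X + Complex.I • Y = 0 → X = 0 ∧ Y = 0)) →
        (∀ (A : Submodule ℝ (Matrix (Fin N) (Fin N) ℂ)), A ≤ L → (∀ H ∈ A, ∀ H' ∈ A, H * H' = H' * H) →
          ∃ E : (↥A →ₗ[ℝ] ℝ) → Submodule ℂ (Matrix (Fin N) (Fin N) ℂ),
            (∀ w, (E w : Set (Matrix (Fin N) (Fin N) ℂ)) =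
                {Z | Z ∈ Submodule.span ℂ (L : Set (Matrix (Fin N) (Fin N) ℂ)) ∧
                  ∀ H : ↥A, (H : Matrix (Fin N) (Fin N) ℂ) * Z - Z * (H : Matrix (Fin N) (Fin N) ℂ) =
                    ((((w H : ℝ) : ℂ)) * Complex.I) • Z}) ∧
            iSupIndep E ∧ (⨆ w, E w) = Submodule.span ℂ (L : Set (Matrix (Fin N) (Fin N) ℂ)) ∧
            {w | E w ≠ ⊥}.Finite ∧
            (∀ w w', ∀ Z ∈ E w, ∀ W ∈ E w', Z * W - W * Z ∈ E (w + w')) ∧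
            (∀ w, ∀ Z ∈ E w, -star Z ∈ E (-w)) ∧
            (∀ H : ↥A, (∀ w, E w ≠ ⊥ → w H = 0) → ∀ X ∈ L, (H : Matrix (Fin N) (Fin N) ℂ) * X = X * (H : Matrix (Fin N) (Fin N) ℂ))) →
        P * P = 1 → P ∈ Matrix.unitaryGroup (Fin N) ℂ → (∀ X ∈ L, P * X * P ∈ L) →
        ∃ A : Submodule ℝ (Matrix (Fin N) (Fin N) ℂ), A ≤ L ∧ (∀ H ∈ A, P * H * P = -H) ∧ (∀ H ∈ A, ∀ H' ∈ A, H * H' = H' * H) ∧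
          Module.finrank ℝ ↥(Submodule.span ℝ ((L : Set (Matrix (Fin N) (Fin N) ℂ)) ∩ {X | P * X * P = -X})) ≤
            Module.finrank ℝ ↥(Submodule.span ℝ ((L : Set (Matrix (Fin N) (Fin N) ℂ)) ∩ {X | P * X * P = X})) + Module.finrank ℝ ↥A ∧
          Module.finrank ℝ ↥(Submodule.span ℝ ((L : Set (Matrix (Fin N) (Fin N) ℂ)) ∩ {X | P * X * P = -X})) +
            Module.finrank ℝ ↥(Submodule.span ℝ ((L : Set (Matrix (Fin N) (Fin N) ℂ)) ∩ {X | P * X * P = X})) = Module.finrank ℝ ↥L := by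
  intro N L P hbr hskew hRS hWD hP _hPU hPL
  obtain ⟨h1, h2, h3⟩ := hRS
  obtain ⟨A, hAp, hAab, hmax⟩ := exists_maximal_abelian (L ⊓ ker (mulLeftRight ℝ (P, P) + 1))
  have hAL : A ≤ L := hAp.trans inf_le_left
  have hAθ : ∀ H ∈ A, P * H * P = -H := fun H hH => (mem_pPart.1 (hAp hH)).2
  refine ⟨A, hAL, hAθ, hAab, ?_, ?_⟩
  · rw [span_inter_neg_eq, span_inter_fix_eq]
    obtain ⟨E, hE1, hE2, hE3, -, -, -, -⟩ := hWD A hAL hAab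
    have hθE : ∀ w, ∀ Z ∈ E w, P * Z * P ∈ E (-w) := fun w Z hZ => conj_mem_weight hP hPL hAθ hE1 w hZ
    have hθ0 : ∀ Z ∈ E 0, P * Z * P ∈ E 0 := fun Z hZ => by
      simpa only [neg_zero] using hθE 0 Z hZ
    have hθN : ∀ Z ∈ ⨆ w ∈ {w : ↥A →ₗ[ℝ] ℝ | w ≠ 0}, E w,
        P * Z * P ∈ ⨆ w ∈ {w : ↥A →ₗ[ℝ] ℝ | w ≠ 0}, E w :=
      fun Z hZ => conj_mem_biSup hθE (fun w hw => neg_ne_zero.2 hw) hZ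
    have hdisj : Disjoint (E 0) (⨆ w ∈ {w : ↥A →ₗ[ℝ] ℝ | w ≠ 0}, E w) :=
      hE2.disjoint_biSup (x := 0) (y := {w : ↥A →ₗ[ℝ] ℝ | w ≠ 0}) fun h => h rfl
    have hsup : E 0 ⊔ (⨆ w ∈ {w : ↥A →ₗ[ℝ] ℝ | w ≠ 0}, E w) =
        Submodule.span ℂ (L : Set (Matrix (Fin N) (Fin N) ℂ)) := by
      rw [← hE3]
      exact (iSup_split_single E 0).symm
    have hAskew : ∀ X ∈ A, star X = -X := fun X hX => hskew X (hAL hX)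
    -- the dimension bookkeeping: `p + k = l`, `l_ℂ = l`, `p ≤ p_ℂ ≤ a + p_N`, `l_ℂ = e₀ + n ≥ a + n`, `2 p_N ≤ n`
    have f1 := finrank_pPart_add_finrank_kPart (L := L) hP hPL
    have f2 : Module.finrank ℂ ↥(Submodule.span ℂ (L : Set (Matrix (Fin N) (Fin N) ℂ))) =
        Module.finrank ℝ ↥L := h1 L hskew
    have f3 : Module.finrank ℝ ↥(L ⊓ ker (mulLeftRight ℝ (P, P) + 1)) ≤ Module.finrank ℂ
        ↥(Submodule.span ℂ (L : Set (Matrix (Fin N) (Fin N) ℂ)) ⊓ ker (mulLeftRight ℂ (P, P) + 1)) := by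
      rw [← h1 (L ⊓ ker (mulLeftRight ℝ (P, P) + 1)) fun X hX => hskew X (mem_pPart.1 hX).1]
      exact Submodule.finrank_mono (Submodule.span_le.2 fun X hX =>
        mem_pPart.2 ⟨Submodule.subset_span (mem_pPart.1 hX).1, (mem_pPart.1 hX).2⟩)
    have f4 : Module.finrank ℂ
        ↥(Submodule.span ℂ (L : Set (Matrix (Fin N) (Fin N) ℂ)) ⊓ ker (mulLeftRight ℂ (P, P) + 1)) ≤
        Module.finrank ℂ ↥(Submodule.span ℂ (L : Set (Matrix (Fin N) (Fin N) ℂ)) ⊓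
          ker (mulLeftRight ℂ (P, P) + 1) ⊓ E 0) +
        Module.finrank ℂ ↥(Submodule.span ℂ (L : Set (Matrix (Fin N) (Fin N) ℂ)) ⊓
          ker (mulLeftRight ℂ (P, P) + 1) ⊓ ⨆ w ∈ {w : ↥A →ₗ[ℝ] ℝ | w ≠ 0}, E w) :=
      (Submodule.finrank_mono (pPart_le_sup _ _ hdisj hsup hθ0 hθN)).trans
        (Submodule.finrank_add_le_finrank_add_finrank _ _)
    have f5 : Module.finrank ℂ ↥(Submodule.span ℂ (L : Set (Matrix (Fin N) (Fin N) ℂ)) ⊓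
        ker (mulLeftRight ℂ (P, P) + 1) ⊓ E 0) ≤ Module.finrank ℝ ↥A := by
      rw [← h1 A hAskew]
      exact Submodule.finrank_mono (pPart_inf_weightZero_le hbr h2 h3 hPL hAL hmax hE1)
    have f6 : Module.finrank ℂ ↥(Submodule.span ℂ (L : Set (Matrix (Fin N) (Fin N) ℂ))) =
        Module.finrank ℂ ↥(E 0) + Module.finrank ℂ ↥(⨆ w ∈ {w : ↥A →ₗ[ℝ] ℝ | w ≠ 0}, E w) := by
      have := Submodule.finrank_sup_add_finrank_inf_eq (E 0) (⨆ w ∈ {w : ↥A →ₗ[ℝ] ℝ | w ≠ 0}, E w)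
      rwa [hsup, disjoint_iff.1 hdisj, finrank_bot, add_zero] at this
    have f7 : Module.finrank ℝ ↥A ≤ Module.finrank ℂ ↥(E 0) := by
      rw [← h1 A hAskew]
      exact Submodule.finrank_mono (span_le_weightZero hAL hAab hE1)
    have f8 : 2 * Module.finrank ℂ ↥(Submodule.span ℂ (L : Set (Matrix (Fin N) (Fin N) ℂ)) ⊓
        ker (mulLeftRight ℂ (P, P) + 1) ⊓ ⨆ w ∈ {w : ↥A →ₗ[ℝ] ℝ | w ≠ 0}, E w) ≤
          Module.finrank ℂ ↥(⨆ w ∈ {w : ↥A →ₗ[ℝ] ℝ | w ≠ 0}, E w) :=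
      two_mul_finrank_le (fun w hw => ne_neg_of_ne_zero w hw) hP hE2 hθE _
        (fun Z hZ => (mem_pPart.1 hZ.1).2) inf_le_right
    omega
  · rw [span_inter_neg_eq, span_inter_fix_eq]
    exact finrank_pPart_add_finrank_kPart hP hPL

end Summit.QuantumFields.YangMills.Theorems.BrascampLiebVacuumSC

end
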